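import Summits.NavierStokesRegularity.NavierStokesRegularity.Theorems.PalasekTowerBreakdownHeredityFromTwoRung
import Summits.NavierStokesRegularity.FluidComputer.PalasekTowerClayBridgeUniquenessHolds

/-!
# NavierStokesRegularity — route `PalasekTowerBreakdown`: under the child crux `HeredityFromTwo`, a
# design carrying ONE registered stage at a generic level BLOWS UP at its scheduled time — so ONE
# global classical solution of a rung-carrying design refutes the child (no cap needed)

Supports `stmt-NavierStokesRegularity-19250` (`PalasekTowerBreakdown.HeredityFromTwo := HeredityFrom 2`);
companion of `Theorems/PalasekTowerBreakdownHeredityFromTwoRung.lean` (p445539; §3 there takes a sup CAP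
`M` as hypothesis). Cell `ns-blowup`, seat `ns-palasek-19250-p1` (g0). LABEL: E–C typing + kernel
bookkeeping (theorems only; no definition, no named fact; standard axioms). WHAT THIS IS NOT: not
Navier–Stokes evidence — no stage, flow or solution is constructed; the child crux is OPEN; every
theorem takes the child and/or a registered stage and/or a global solution as a HYPOTHESIS.

SHARPENING OF THE LEVER. The cap of p445539 §3 is not needed: the readout points `x_k` of a design's
registered stages lie in the CLOSED ball of radius `S.radius` and the readout times `τ_k` in
`[0, S.T]`, a COMPACT set on which any classical velocity field on the closed slab `[0, S.T] × ℝ³` is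
bounded (joint smoothness ⇒ continuity), while Tao's forced uniqueness (Cor. 11.4 with a Clay-class
force — the tree's theorem `tao_unconditional_uniqueness_velocity_forced_holds`, no W14 hypothesis)
identifies every registered stage of the design with that field on its slab. Hence:

* `palasekTowerBreakdown_stage_velocity_eq_solution` — a registered stage of `S` at level `k`
  coincides on `[0, τ k]` with ANY classical finite-energy solution of `S`'s forced Cauchy problem on a
  closed slab `[0, T']`, `τ k ≤ T'`;
* **`palasekTowerBreakdown_heredityFromTwo_no_global_solution`** — under the child, a pinned rigid
  quiet wide schedule `S` with a registered stage at some level `k₀ ≥ 2` admits NO classical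
  finite-energy solution of its forced Cauchy problem on any closed slab `[0, T']` with `S.T ≤ T'`:
  THE DESIGN'S FLOW LEAVES THE CLASSICAL FINITE-ENERGY CLASS AT OR BEFORE ITS SCHEDULED TIME `S.T`
  (`τ_k ↑`, `τ_k < S.T`, speeds `≥ Y_k → ∞` in the ball);
* **`palasekTowerBreakdown_not_heredityFromTwo_of_global_solution`** — contrapositive: ONE pinned rigid
  quiet wide schedule carrying a registered stage at a level `≥ 2` AND a classical finite-energy
  solution of its own forced Cauchy problem on `[0, S.T]` REFUTES the child. For an axisymmetric
  swirl-free design the second object is the printed global regularity of that class (Ladyzhenskaya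
  1968 / Ukhovskii–Yudovich 1968; NOT in the tree, NOT used); the first is an open construction.
* `palasekTowerBreakdown_heredityFromTwo_exists_blowup_design_of_rungG` — `∃`-packaged reading:
  `HeredityFromTwo → (∃ k₀ ≥ 2, RungG k₀) →` some Clay datum / Clay-class force (those of a pinned rigid
  quiet wide schedule) whose forced Cauchy problem has no classical finite-energy solution on `[0, S.T]`.

References: T. Tao, Anal. PDE 6 (2013), Cor. 11.4 [cite: Tao2011, Cor. 11.4]; S. Palasek,
arXiv:2605.13827 §4 [cite: Palasek2026ElementaryModel, §4]; C. L. Fefferman, Clay problem description,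
(C) [cite: FeffermanClay2006, (C)].
-/

-- `Summit.<Summit>.<Problem>` is the tree's mandated summit-side namespace (CONVENTIONS §2); for this
-- single-conjunct summit the two coincide, so the duplicate is deliberate.
set_option linter.dupNamespace false

noncomputable section

namespace Summit.NavierStokesRegularity.NavierStokesRegularity.Theorems

open Set MeasureTheory Filter Topology Function
open scoped ENNReal
open Summit.NavierStokesRegularity.NavierStokesRegularity.Theses
open Summit.NavierStokesRegularity.FluidComputer.PalasekTowerClayBridge
open Literature.Analysis.FluidPDE

section Global

variable {S : Schedule TowerRates.wide}

/-- **A registered stage IS the design's flow on its slab**: a registered stage `s` of `S` at level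
`k` (unit viscosity) agrees in velocity on `[0, τ k]` with ANY classical finite-energy solution `(U, P)`
of `S`'s forced Cauchy problem (force `S.f`, datum `S.u₀`) on a closed slab `[0, T']`, `τ k ≤ T'`
(Tao's forced uniqueness with a Clay-class force, a theorem of the tree; the datum is `H¹`,
`Stage.memLp_datum`). [cite: Tao2011, Cor. 11.4] -/
theorem palasekTowerBreakdown_stage_velocity_eq_solution {k : ℕ}
    (s : Stage 1 TowerRates.wide S (Margins.routeG TowerRates.wide) k) {T' : ℝ} (hT' : S.τ k ≤ T')
    {U : ℝ → EuclideanSpace ℝ (Fin 3) → EuclideanSpace ℝ (Fin 3)}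
    {P : ℝ → EuclideanSpace ℝ (Fin 3) → ℝ} (hU : IsClassicalNSSolutionOn (Icc 0 T') 1 S.f U P)
    (hU0 : U 0 = S.u₀) (hUE : ∃ C : ℝ≥0∞, C < ⊤ ∧ ∀ t ∈ Icc 0 T', ∫⁻ x, ‖U t x‖ₑ ^ 2 ≤ C) :
    ∀ t ∈ Icc 0 (S.τ k), s.u t = U t := by
  have hUk : IsClassicalNSSolutionOn (Icc 0 (S.τ k)) 1 S.f U P :=
    hU.mono (Icc_subset_Icc le_rfl hT') (uniqueDiffOn_Icc (S.τ_pos k))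
  have hUEk : ∃ C : ℝ≥0∞, C < ⊤ ∧ ∀ t ∈ Icc 0 (S.τ k), ∫⁻ x, ‖U t x‖ₑ ^ 2 ≤ C := by
    obtain ⟨C, hC, hb⟩ := hUE
    exact ⟨C, hC, fun t ht => hb t ⟨ht.1, ht.2.trans hT'⟩⟩
  exact tao_unconditional_uniqueness_velocity_forced_holds 1 (S.τ k) one_pos (S.τ_pos k) S.u₀
    s.memLp_datum.1 s.memLp_datum.2 S.f S.force_smooth S.force_decay s.u U s.p P s.classical hUk
    s.initial hU0 s.energy hUEk

/-- A classical velocity field on a closed slab `[0, T']` is bounded on `[0, T'] × B̄(0, r)` (joint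
smoothness ⇒ continuity on a compact set). [folklore] -/
theorem palasekTowerBreakdown_solution_bounded_on_ball {T' r : ℝ}
    {f U : ℝ → EuclideanSpace ℝ (Fin 3) → EuclideanSpace ℝ (Fin 3)}
    {P : ℝ → EuclideanSpace ℝ (Fin 3) → ℝ} (hU : IsClassicalNSSolutionOn (Icc 0 T') 1 f U P) :
    ∃ M : ℝ, ∀ t ∈ Icc 0 T', ∀ x : EuclideanSpace ℝ (Fin 3), ‖x‖ ≤ r → ‖U t x‖ ≤ M := by
  have hK : IsCompact (Icc (0 : ℝ) T' ×ˢ Metric.closedBall (0 : EuclideanSpace ℝ (Fin 3)) r) :=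
    isCompact_Icc.prod (isCompact_closedBall _ _)
  have hc : ContinuousOn (uncurry U) (Icc (0 : ℝ) T' ×ˢ Metric.closedBall (0 : EuclideanSpace ℝ (Fin 3)) r) :=
    hU.smooth_velocity.continuousOn.mono (prod_mono le_rfl (subset_univ _))
  obtain ⟨M, hM⟩ := hK.exists_bound_of_continuousOn hc
  refine ⟨M, fun t ht x hx => ?_⟩
  have hmem : (t, x) ∈ Icc (0 : ℝ) T' ×ˢ Metric.closedBall (0 : EuclideanSpace ℝ (Fin 3)) r :=
    mk_mem_prod ht (by simpa [Metric.mem_closedBall, dist_zero_right] using hx)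
  exact hM (t, x) hmem

/-- **UNDER THE CHILD, A RUNG-CARRYING DESIGN BLOWS UP AT ITS SCHEDULED TIME**: if `HeredityFromTwo`
holds and a pinned (`Λ = 8`, `θ = 6/5`) rigid quiet schedule `S` on the wide-base rates carries a
registered stage at some level `k₀ ≥ 2`, then `S`'s forced Cauchy problem (force `S.f`, Clay datum
`S.u₀`, unit viscosity) has NO classical finite-energy solution on any closed slab `[0, T']` with
`S.T ≤ T'` — the registered stages of `S` at all levels (p445539 §2) read speeds `≥ Y_k → ∞` at the
points `x_k ∈ B̄(0, S.radius)` and times `τ_k < S.T`, and each of them IS the solution on its slab.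
Nothing is asserted: both hypotheses are OPEN. [cite: Palasek2026ElementaryModel, §4; Tao2011, Cor. 11.4] -/
theorem palasekTowerBreakdown_heredityFromTwo_no_global_solution
    (h : PalasekTowerBreakdown.HeredityFromTwo) (hP : S.Pins 8 (6 / 5)) (hR : S.Rigid) (hQ : S.Quiet)
    {k₀ : ℕ} (hk₀ : 2 ≤ k₀) (s : Stage 1 TowerRates.wide S (Margins.routeG TowerRates.wide) k₀)
    {T' : ℝ} (hT' : S.T ≤ T') {U : ℝ → EuclideanSpace ℝ (Fin 3) → EuclideanSpace ℝ (Fin 3)}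
    {P : ℝ → EuclideanSpace ℝ (Fin 3) → ℝ} (hU : IsClassicalNSSolutionOn (Icc 0 T') 1 S.f U P)
    (hU0 : U 0 = S.u₀) (hUE : ∃ C : ℝ≥0∞, C < ⊤ ∧ ∀ t ∈ Icc 0 T', ∫⁻ x, ‖U t x‖ₑ ^ 2 ≤ C) :
    False := by
  obtain ⟨M, hM⟩ := palasekTowerBreakdown_solution_bounded_on_ball (r := S.radius) hU
  obtain ⟨k, s', x, hx, hMx⟩ :=
    palasekTowerBreakdown_heredityFromTwo_speed_unbounded h hP hR hQ hk₀ s M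
  have hτ : S.τ k ≤ T' := (S.τ_lt_T k).le.trans hT'
  have heq : s'.u (S.τ k) = U (S.τ k) :=
    palasekTowerBreakdown_stage_velocity_eq_solution s' hτ hU hU0 hUE (S.τ k)
      ⟨(S.τ_pos k).le, le_rfl⟩
  rw [heq] at hMx
  exact absurd (hM (S.τ k) ⟨(S.τ_pos k).le, hτ⟩ x hx) (not_le.2 hMx)

/-- **ONE GLOBAL SOLUTION OF A RUNG-CARRYING DESIGN REFUTES THE CHILD** (contrapositive): a pinned rigid
quiet wide schedule `S` with a registered stage at some level `k₀ ≥ 2` AND a classical finite-energy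
solution of its own forced Cauchy problem on the closed slab `[0, S.T]` gives `¬ HeredityFromTwo`. No
cap, no symmetry hypothesis; for an axisymmetric swirl-free design the solution is the printed global
regularity of that class (not in the tree, not used), the stage an open construction.
[cite: Palasek2026ElementaryModel, §4; Tao2011, Cor. 11.4] -/
theorem palasekTowerBreakdown_not_heredityFromTwo_of_global_solution (hP : S.Pins 8 (6 / 5))
    (hR : S.Rigid) (hQ : S.Quiet) {k₀ : ℕ} (hk₀ : 2 ≤ k₀)
    (s : Stage 1 TowerRates.wide S (Margins.routeG TowerRates.wide) k₀)
    {U : ℝ → EuclideanSpace ℝ (Fin 3) → EuclideanSpace ℝ (Fin 3)}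
    {P : ℝ → EuclideanSpace ℝ (Fin 3) → ℝ} (hU : IsClassicalNSSolutionOn (Icc 0 S.T) 1 S.f U P)
    (hU0 : U 0 = S.u₀) (hUE : ∃ C : ℝ≥0∞, C < ⊤ ∧ ∀ t ∈ Icc 0 S.T, ∫⁻ x, ‖U t x‖ₑ ^ 2 ≤ C) :
    ¬ PalasekTowerBreakdown.HeredityFromTwo := fun h =>
  palasekTowerBreakdown_heredityFromTwo_no_global_solution h hP hR hQ hk₀ s le_rfl hU hU0 hUE

/-- The same against the PARENT crux `EpisodeInduction` (which contains the child).
[cite: Palasek2026ElementaryModel, §4] -/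
theorem palasekTowerBreakdown_not_episodeInduction_of_global_solution (hP : S.Pins 8 (6 / 5))
    (hR : S.Rigid) (hQ : S.Quiet) {k₀ : ℕ} (hk₀ : 2 ≤ k₀)
    (s : Stage 1 TowerRates.wide S (Margins.routeG TowerRates.wide) k₀)
    {U : ℝ → EuclideanSpace ℝ (Fin 3) → EuclideanSpace ℝ (Fin 3)}
    {P : ℝ → EuclideanSpace ℝ (Fin 3) → ℝ} (hU : IsClassicalNSSolutionOn (Icc 0 S.T) 1 S.f U P)
    (hU0 : U 0 = S.u₀) (hUE : ∃ C : ℝ≥0∞, C < ⊤ ∧ ∀ t ∈ Icc 0 S.T, ∫⁻ x, ‖U t x‖ₑ ^ 2 ≤ C) :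
    ¬ PalasekTowerBreakdown.EpisodeInduction := fun h =>
  palasekTowerBreakdown_not_heredityFromTwo_of_global_solution hP hR hQ hk₀ s hU hU0 hUE
    (EpisodeInductionG.heredityFrom h (by norm_num))

/-- **`∃`-packaged reading — the child plus a generic rung asserts a forced Clay-class blow-up by
time `S.T`**: under `HeredityFromTwo` and `RungG k₀` for some `k₀ ≥ 2`, there are a Clay datum `u₀`
(rapid decay) and a Clay-class force `f` (smooth on the closed half-space, rapid space-time decay) —
those of a pinned rigid quiet wide schedule — and a time `T > 0` such that the forced Cauchy problem
has NO classical finite-energy solution on `[0, T]`. Nothing is asserted. [cite: FeffermanClay2006, (C)] -/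
theorem palasekTowerBreakdown_heredityFromTwo_exists_blowup_design_of_rungG
    (h : PalasekTowerBreakdown.HeredityFromTwo) (hK : ∃ k₀, 2 ≤ k₀ ∧ RungG k₀) :
    ∃ (u₀ : EuclideanSpace ℝ (Fin 3) → EuclideanSpace ℝ (Fin 3))
      (f : ℝ → EuclideanSpace ℝ (Fin 3) → EuclideanSpace ℝ (Fin 3)) (T : ℝ),
      HasRapidSpatialDecay u₀ ∧ IsSmoothOnHalfSpace f ∧ HasRapidSpaceTimeDecay f ∧ 0 < T ∧
      ¬ ∃ (U : ℝ → EuclideanSpace ℝ (Fin 3) → EuclideanSpace ℝ (Fin 3))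
          (P : ℝ → EuclideanSpace ℝ (Fin 3) → ℝ),
          IsClassicalNSSolutionOn (Icc 0 T) 1 f U P ∧ U 0 = u₀ ∧
          ∃ C : ℝ≥0∞, C < ⊤ ∧ ∀ t ∈ Icc 0 T, ∫⁻ x, ‖U t x‖ₑ ^ 2 ≤ C := by
  obtain ⟨k₀, hk₀, S, hP, hR, hQ, ⟨s⟩⟩ := hK
  refine ⟨S.u₀, S.f, S.T, S.datum_decay, S.force_smooth, S.force_decay, S.T_pos, ?_⟩
  rintro ⟨U, P, hU, hU0, hUE⟩
  exact palasekTowerBreakdown_heredityFromTwo_no_global_solution h hP hR hQ hk₀ s le_rfl hU hU0 hUE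

end Global

end Summit.NavierStokesRegularity.NavierStokesRegularity.Theorems

end
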